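import Mathlib
import Literature.RingTheory.CohomologyAnnihilator.StableAnnihilation
import Literature.RingTheory.CohomologyAnnihilator.StrongGenerator
import HarnessLib

/-!
# The rank-one trace criterion: stable annihilation of an ideal is its trace ideal `𝔞·𝔞⁻¹`

Crux `HomologicalConductor.Persistence` (stmt-ResolutionOfSingularities-16484), chain W4.4b, helper
H-f (stub-2, announced 19:30Z): the algebraic skeleton of mechanism M-C+ ("`x` stably kills the
recurrent divisorial modules") and of the modelling step `ca(T) = ⋂_{j recurrent} M_j·M_{-j}` of the
toric scans (crux NOTES §5, Disproof §4).

For a commutative DOMAIN `R` with fraction field `K`, a nonzero ideal `𝔞 ⊆ R` and `x ∈ R`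
(`𝔞⁻¹ = (R :_K 𝔞)`, Mathlib's `FractionalIdeal` inverse):

* `exists_factor_iff_mem_mul_inv` — the homothety `x • 𝟙_𝔞` factors `R`-linearly through a
  finitely generated free module **iff** `x ∈ 𝔞·𝔞⁻¹` (the trace ideal of `𝔞`): every linear form
  on `𝔞` is multiplication by an element of `𝔞⁻¹` (`exists_mem_inv_forall_eq_mul`), so a
  factorisation `π ∘ ι = x • 𝟙` reads `x = Σ q_k m_k` with `q_k ∈ 𝔞⁻¹`, `m_k ∈ 𝔞`, and conversely.
* `smul_ext_eq_zero_of_mem_mul_inv` — hence `x ∈ 𝔞·𝔞⁻¹` kills `Extⁱ_R(𝔞, –)` for all `i ≥ 1`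
  (tree `smul_ext_eq_zero_of_comp_eq_smul_id`).
* `mem_mul_inv_of_forall_smul_ext_one_eq_zero` — conversely (`R` noetherian) if `x` kills
  `Ext¹_R(𝔞, N)` for all finitely generated `N`, then `x ∈ 𝔞·𝔞⁻¹` (tree splitting criterion
  `exists_comp_eq_smul_id_X₃_of_smul_extClass_eq_zero` on a finite free presentation of `𝔞`).
* `mem_mul_inv_of_mem_cohomologyAnnihilatorOfDegree_of_isSyzygy` — so an element of `caˢ⁺¹(R)`
  lies in the trace ideal of every ideal that is an `s`-th syzygy; in particular `ca(R)` is
  contained in the trace ideals of all divisorial ideals occurring as high syzygies (with equality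
  when the high syzygies are sums of rank-one modules, e.g. toric surfaces — not claimed here).

`[OURS · L1 w44b]`; folklore commutative algebra (trace ideals vs. stable endomorphisms), not a
statement of any manuscript.
-/

-- single-problem summit: the doubled namespace component is forced
set_option linter.dupNamespace false

noncomputable section

open CategoryTheory CategoryTheory.Abelian
open scoped nonZeroDivisors

namespace Summit.ResolutionOfSingularities.ResolutionOfSingularities.Theorems.HomologicalConductor.PersistenceTraceCriterion

open Literature.RingTheory.CohomologyAnnihilator

universe u

variable {R : Type u} [CommRing R] [IsDomain R] {K : Type u} [Field K] [Algebra R K]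
  [IsFractionRing R K]

/-! ## Linear forms on an ideal are fractions -/

/-- **Every `R`-linear form on a nonzero ideal `𝔞` of a domain is multiplication by an element of
`𝔞⁻¹ = (R :_K 𝔞)`**: `φ(a) = q · a` with `q = φ(a₀)/a₀` for any `0 ≠ a₀ ∈ 𝔞`
(`a₀ φ(a) = φ(a₀ a) = a φ(a₀)`). [folklore] -/
theorem exists_mem_inv_forall_eq_mul (I : Ideal R) (hI : I ≠ ⊥) (φ : ↥I →ₗ[R] R) :
    ∃ q : K, q ∈ (I : FractionalIdeal R⁰ K)⁻¹ ∧
      ∀ a : ↥I, algebraMap R K (φ a) = q * algebraMap R K (a : R) := by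
  obtain ⟨a₀, ha₀I, ha₀⟩ := Submodule.exists_mem_ne_zero_of_ne_bot hI
  have hinj : Function.Injective (algebraMap R K) := IsFractionRing.injective R K
  have ha₀K : algebraMap R K a₀ ≠ 0 := fun h => ha₀ (hinj (by rw [h, map_zero]))
  -- the key identity `a₀ φ(a) = a φ(a₀)`
  have key : ∀ a : ↥I, a₀ * φ a = (a : R) * φ ⟨a₀, ha₀I⟩ := by
    intro a
    have h1 : φ (a₀ • a) = a₀ • φ a := map_smul φ a₀ a
    have h2 : φ ((a : R) • (⟨a₀, ha₀I⟩ : ↥I)) = (a : R) • φ ⟨a₀, ha₀I⟩ := map_smul φ _ _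
    have h3 : a₀ • a = (a : R) • (⟨a₀, ha₀I⟩ : ↥I) := by
      apply Subtype.ext
      change a₀ * (a : R) = (a : R) * a₀
      exact mul_comm _ _
    simp only [smul_eq_mul] at h1 h2
    rw [← h1, h3, h2]
  refine ⟨algebraMap R K (φ ⟨a₀, ha₀I⟩) / algebraMap R K a₀, ?_, fun a => ?_⟩
  · rw [FractionalIdeal.mem_inv_iff (FractionalIdeal.coeIdeal_ne_zero.mpr hI)]
    intro y hy
    obtain ⟨a, haI, rfl⟩ := (FractionalIdeal.mem_coeIdeal R⁰).mp hy
    rw [FractionalIdeal.mem_one_iff]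
    refine ⟨φ ⟨a, haI⟩, ?_⟩
    rw [div_mul_eq_mul_div, eq_div_iff ha₀K, ← map_mul, ← map_mul, mul_comm (φ ⟨a, haI⟩),
      key ⟨a, haI⟩, mul_comm]
  · rw [div_mul_eq_mul_div, eq_comm, div_eq_iff ha₀K, ← map_mul, ← map_mul, mul_comm (φ a),
      key a, mul_comm]


/-! ## A factorisation of `x • 𝟙_𝔞` through a free module puts `x` in the trace ideal -/

/-- If `x • 𝟙_𝔞` factors `R`-linearly as `𝔞 —ι→ Rⁿ —π→ 𝔞`, then `x ∈ 𝔞·𝔞⁻¹`: writing the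
coordinates of `ι` as fractions `q_k ∈ 𝔞⁻¹` and `m_k = π(e_k) ∈ 𝔞`, `x = Σ q_k m_k`. [folklore] -/
theorem mem_mul_inv_of_factor (I : Ideal R) (hI : I ≠ ⊥) {x : R} {n : ℕ}
    (ι : ↥I →ₗ[R] (Fin n → R)) (π : (Fin n → R) →ₗ[R] ↥I) (h : ∀ a : ↥I, π (ι a) = x • a) :
    algebraMap R K x ∈ (I : FractionalIdeal R⁰ K) * (I : FractionalIdeal R⁰ K)⁻¹ := by
  classical
  obtain ⟨a₀, ha₀I, ha₀⟩ := Submodule.exists_mem_ne_zero_of_ne_bot hI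
  have hinj : Function.Injective (algebraMap R K) := IsFractionRing.injective R K
  have ha₀K : algebraMap R K a₀ ≠ 0 := fun h => ha₀ (hinj (by rw [h, map_zero]))
  -- coordinates of `ι` are fractions `q k ∈ I⁻¹`
  have hq : ∀ k : Fin n, ∃ q : K, q ∈ (I : FractionalIdeal R⁰ K)⁻¹ ∧
      ∀ a : ↥I, algebraMap R K (ι a k) = q * algebraMap R K (a : R) :=
    fun k => exists_mem_inv_forall_eq_mul I hI ((LinearMap.proj k).comp ι)
  choose q hqinv hq using hq
  -- the basis images `m k = π(e_k) ∈ I`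
  set m : Fin n → R := fun k => ((π (fun j => if k = j then 1 else 0) : ↥I) : R) with hm
  have hmI : ∀ k, m k ∈ I := fun k => (π _).2
  -- `x a₀ = Σ_k ι(a₀)_k m_k` in `R`
  have h1 : x * a₀ = ∑ k, ι ⟨a₀, ha₀I⟩ k * m k := by
    have h2 := h ⟨a₀, ha₀I⟩
    rw [LinearMap.pi_apply_eq_sum_univ π (ι ⟨a₀, ha₀I⟩)] at h2
    have h3 := congrArg (fun z : ↥I => (z : R)) h2
    simp only [AddSubmonoidClass.coe_finsetSum, SetLike.val_smul, smul_eq_mul] at h3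
    rw [← h3]
  -- pass to `K` and cancel `a₀`
  have h4 : algebraMap R K x * algebraMap R K a₀ =
      (∑ k, q k * algebraMap R K (m k)) * algebraMap R K a₀ := by
    rw [← map_mul, h1, map_sum, Finset.sum_mul]
    refine Finset.sum_congr rfl fun k _ => ?_
    rw [map_mul, hq k ⟨a₀, ha₀I⟩]
    ring
  have h5 : algebraMap R K x = ∑ k, q k * algebraMap R K (m k) := mul_right_cancel₀ ha₀K h4
  rw [h5]
  refine Submodule.sum_mem _ fun k _ => ?_
  rw [mul_comm (q k)]
  exact FractionalIdeal.mul_mem_mul (FractionalIdeal.mem_coeIdeal_of_mem R⁰ (hmI k)) (hqinv k)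

/-! ## Conversely, elements of the trace ideal factor through free modules -/

omit [IsDomain R] [IsFractionRing R K] in
/-- The factorisation property is closed under addition (direct sum of the two factorisations,
`R^{n₁+n₂} ≃ R^{n₁} × R^{n₂}`). [folklore] -/
private theorem factors_add (I : Ideal R) {y₁ y₂ : K}
    (h₁ : (∃ (n : ℕ) (ι : ↥I →ₗ[R] (Fin n → R)) (π : (Fin n → R) →ₗ[R] ↥I),
      ∀ a : ↥I, algebraMap R K ((π (ι a) : ↥I) : R) = y₁ * algebraMap R K (a : R)))
    (h₂ : (∃ (n : ℕ) (ι : ↥I →ₗ[R] (Fin n → R)) (π : (Fin n → R) →ₗ[R] ↥I),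
      ∀ a : ↥I, algebraMap R K ((π (ι a) : ↥I) : R) = y₂ * algebraMap R K (a : R))) :
    (∃ (n : ℕ) (ι : ↥I →ₗ[R] (Fin n → R)) (π : (Fin n → R) →ₗ[R] ↥I),
      ∀ a : ↥I, algebraMap R K ((π (ι a) : ↥I) : R) = (y₁ + y₂) * algebraMap R K (a : R)) := by
  obtain ⟨n₁, ι₁, π₁, h₁⟩ := h₁
  obtain ⟨n₂, ι₂, π₂, h₂⟩ := h₂
  -- `R^{n₁+n₂} ≃ R^{n₁} × R^{n₂}`
  let E : (Fin (n₁ + n₂) → R) ≃ₗ[R] (Fin n₁ → R) × (Fin n₂ → R) :=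
    (LinearEquiv.funCongrLeft R R finSumFinEquiv).trans
      (LinearEquiv.sumArrowLequivProdArrow (Fin n₁) (Fin n₂) R R)
  refine ⟨n₁ + n₂, E.symm.toLinearMap ∘ₗ (ι₁.prod ι₂), (π₁.coprod π₂) ∘ₗ E.toLinearMap, fun a => ?_⟩
  simp only [LinearMap.coe_comp, LinearEquiv.coe_toLinearMap, Function.comp_apply,
    LinearEquiv.apply_symm_apply, LinearMap.prod_apply, LinearMap.coprod_apply, Submodule.coe_add,
    map_add]
  change algebraMap R K ((π₁ (ι₁ a) : ↥I) : R) + algebraMap R K ((π₂ (ι₂ a) : ↥I) : R) = _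
  rw [h₁ a, h₂ a, add_mul]

/-- The factorisation property holds for a generator `m·q` of `𝔞·𝔞⁻¹` (`m ∈ 𝔞`, `q ∈ 𝔞⁻¹`): factor through
`R¹` by `a ↦ q a ∈ R` and `r ↦ r m`. [folklore] -/
private theorem factors_mul (I : Ideal R) {m : R} (hm : m ∈ I) {q : K}
    (hq : q ∈ (I : FractionalIdeal R⁰ K)⁻¹) (hI : I ≠ ⊥) :
    (∃ (n : ℕ) (ι : ↥I →ₗ[R] (Fin n → R)) (π : (Fin n → R) →ₗ[R] ↥I),
      ∀ a : ↥I, algebraMap R K ((π (ι a) : ↥I) : R) = (algebraMap R K m * q) * algebraMap R K (a : R)) := by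
  have hinj : Function.Injective (algebraMap R K) := IsFractionRing.injective R K
  -- `a ↦ q · a` lands in `R ⊆ K`
  have hqa : ∀ a : ↥I, ∃ r : R, algebraMap R K r = q * algebraMap R K (a : R) := by
    intro a
    have := (FractionalIdeal.mem_inv_iff (FractionalIdeal.coeIdeal_ne_zero.mpr hI)).mp hq
      (algebraMap R K (a : R)) (FractionalIdeal.mem_coeIdeal_of_mem R⁰ a.2)
    exact (FractionalIdeal.mem_one_iff R⁰).mp this
  choose r hr using hqa
  -- it is `R`-linear (by injectivity of `R → K`)
  let ψ : ↥I →ₗ[R] R :=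
    { toFun := r
      map_add' := fun a b => hinj (by
        rw [map_add, hr, hr, hr, Submodule.coe_add, map_add, mul_add])
      map_smul' := fun c a => hinj (by
        rw [RingHom.id_apply, smul_eq_mul, map_mul, hr, hr, SetLike.val_smul, smul_eq_mul,
          map_mul]
        ring) }
  refine ⟨1, LinearMap.pi fun _ => ψ, (LinearMap.proj 0).smulRight ⟨m, hm⟩, fun a => ?_⟩
  simp only [LinearMap.pi_apply, LinearMap.smulRight_apply, LinearMap.coe_proj,
    Function.eval, SetLike.val_smul, smul_eq_mul, map_mul]
  change algebraMap R K (r a) * algebraMap R K m = _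
  rw [hr]
  ring

/-- **If `x ∈ 𝔞·𝔞⁻¹` then `x • 𝟙_𝔞` factors through a finitely generated free module**: for a
generator `m·q` (`m ∈ 𝔞`, `q ∈ 𝔞⁻¹`) use `a ↦ q a ∈ R` and `r ↦ r m`; sums by direct sums.
[folklore] -/
theorem exists_factor_of_mem_mul_inv (I : Ideal R) (hI : I ≠ ⊥) {x : R}
    (hx : algebraMap R K x ∈ (I : FractionalIdeal R⁰ K) * (I : FractionalIdeal R⁰ K)⁻¹) :
    ∃ (n : ℕ) (ι : ↥I →ₗ[R] (Fin n → R)) (π : (Fin n → R) →ₗ[R] ↥I),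
      ∀ a : ↥I, π (ι a) = x • a := by
  have hinj : Function.Injective (algebraMap R K) := IsFractionRing.injective R K
  have hx' : algebraMap R K x ∈ ((I : FractionalIdeal R⁰ K) : Submodule R K) *
      (((I : FractionalIdeal R⁰ K)⁻¹ : FractionalIdeal R⁰ K) : Submodule R K) := by
    rw [← FractionalIdeal.coe_mul]; exact hx
  have hF : (∃ (n : ℕ) (ι : ↥I →ₗ[R] (Fin n → R)) (π : (Fin n → R) →ₗ[R] ↥I),
      ∀ a : ↥I, algebraMap R K ((π (ι a) : ↥I) : R) = algebraMap R K x * algebraMap R K (a : R)) := by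
    refine Submodule.mul_induction_on
      (C := fun y => (∃ (n : ℕ) (ι : ↥I →ₗ[R] (Fin n → R)) (π : (Fin n → R) →ₗ[R] ↥I),
      ∀ a : ↥I, algebraMap R K ((π (ι a) : ↥I) : R) = y * algebraMap R K (a : R)))
      hx' (fun m' hm' q hq => ?_) fun y₁ y₂ h₁ h₂ => factors_add I h₁ h₂
    obtain ⟨m, hm, rfl⟩ := (FractionalIdeal.mem_coeIdeal R⁰).mp hm'
    exact factors_mul I hm hq hI
  obtain ⟨n, ι, π, hF⟩ := hF
  refine ⟨n, ι, π, fun a => Subtype.ext (hinj ?_)⟩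
  rw [hF a, SetLike.val_smul, smul_eq_mul, map_mul]

/-- **Rank-one trace criterion.** For a nonzero ideal `𝔞` of a domain `R` with fraction field `K`
and `x ∈ R`: the homothety `x • 𝟙_𝔞` factors `R`-linearly through a finitely generated free module
iff `x ∈ 𝔞·𝔞⁻¹` (the trace ideal of `𝔞`). [folklore] -/
theorem exists_factor_iff_mem_mul_inv (I : Ideal R) (hI : I ≠ ⊥) (x : R) :
    (∃ (n : ℕ) (ι : ↥I →ₗ[R] (Fin n → R)) (π : (Fin n → R) →ₗ[R] ↥I),
        ∀ a : ↥I, π (ι a) = x • a) ↔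
      algebraMap R K x ∈ (I : FractionalIdeal R⁰ K) * (I : FractionalIdeal R⁰ K)⁻¹ :=
  ⟨fun ⟨_, ι, π, h⟩ => mem_mul_inv_of_factor I hI ι π h, exists_factor_of_mem_mul_inv I hI⟩


/-! ## Consequences for `Ext` and for the cohomology annihilator -/

/-- **The trace ideal annihilates positive `Ext` out of `𝔞`**: if `x ∈ 𝔞·𝔞⁻¹` then
`x · Extⁱ_R(𝔞, N) = 0` for every `R`-module `N` and `i ≥ 1` — `x • 𝟙_𝔞` factors through a
finitely generated free (hence projective) module (tree `smul_ext_eq_zero_of_comp_eq_smul_id`).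
[folklore] -/
theorem smul_ext_eq_zero_of_mem_mul_inv (I : Ideal R) (hI : I ≠ ⊥) {x : R}
    (hx : algebraMap R K x ∈ (I : FractionalIdeal R⁰ K) * (I : FractionalIdeal R⁰ K)⁻¹)
    (N : ModuleCat.{u} R) {i : ℕ} (hi : 1 ≤ i) (e : Ext.{u} (ModuleCat.of R ↥I) N i) :
    x • e = 0 := by
  obtain ⟨n, ι, π, h⟩ := exists_factor_of_mem_mul_inv I hI hx
  refine smul_ext_eq_zero_of_comp_eq_smul_id (P := ModuleCat.of R (Fin n → R))
    (ModuleCat.ofHom ι) (ModuleCat.ofHom π) ?_ hi e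
  apply ModuleCat.hom_ext
  refine LinearMap.ext fun a => ?_
  change π (ι a) = x • a
  exact h a

/-- **Conversely, stable annihilation of `Ext¹` forces membership in the trace ideal**
(`R` noetherian): if `x · Ext¹_R(𝔞, N) = 0` for all finitely generated `N`, then `x ∈ 𝔞·𝔞⁻¹` —
on a finite free presentation `0 → L → Rⁿ → 𝔞 → 0` the class is killed by `x`, so `x • 𝟙_𝔞` lifts
to `Rⁿ` (tree splitting criterion `exists_comp_eq_smul_id_X₃_of_smul_extClass_eq_zero`,
[IyengarTakahashi2014, Remark 2.13]) and `mem_mul_inv_of_factor` applies.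
[cite: IyengarTakahashi2014, Remark 2.13] -/
theorem mem_mul_inv_of_forall_smul_ext_one_eq_zero [IsNoetherianRing R] (I : Ideal R) (hI : I ≠ ⊥)
    {x : R} (h : ∀ (N : ModuleCat.{u} R), Module.Finite R N →
      ∀ e : Ext.{u} (ModuleCat.of R ↥I) N 1, x • e = 0) :
    algebraMap R K x ∈ (I : FractionalIdeal R⁰ K) * (I : FractionalIdeal R⁰ K)⁻¹ := by
  obtain ⟨n, f, hf⟩ := Module.Finite.exists_fin' R ↥I
  have hS := LinearMap.shortExact_shortComplexKer hf
  haveI : Module.Finite R (LinearMap.ker f) := Module.IsNoetherian.finite R _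
  have hcls : x • hS.extClass = 0 := h (ModuleCat.of R (LinearMap.ker f)) inferInstance _
  obtain ⟨ψ, hψ⟩ := exists_comp_eq_smul_id_X₃_of_smul_extClass_eq_zero hS hcls
  refine mem_mul_inv_of_factor I hI ψ.hom f fun a => ?_
  have := congrArg (fun φ => φ.hom a) hψ
  simpa using this

/-- **An element of `caˢ⁺¹(R)` lies in the trace ideal of every nonzero ideal that is an `s`-th
syzygy** of a finitely generated module: it kills `Ext¹_R(𝔞, –) ≅ Ext^{s+1}_R(X, –)` on finitely
generated modules (dimension shifting, tree `ext_smul_eq_zero_of_isSyzygy`), so the previous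
theorem applies. [cite: IyengarTakahashi2014, Remark 2.13] -/
theorem mem_mul_inv_of_mem_cohomologyAnnihilatorOfDegree_of_isSyzygy [IsNoetherianRing R]
    (I : Ideal R) (hI : I ≠ ⊥) {x : R} {s : ℕ} (hx : x ∈ cohomologyAnnihilatorOfDegree R (s + 1))
    {X : ModuleCat.{u} R} [Module.Finite R X] (hIX : IsSyzygy s X (ModuleCat.of R ↥I)) :
    algebraMap R K x ∈ (I : FractionalIdeal R⁰ K) * (I : FractionalIdeal R⁰ K)⁻¹ := by
  refine mem_mul_inv_of_forall_smul_ext_one_eq_zero I hI fun N hN e => ?_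
  haveI := hN
  exact ext_smul_eq_zero_of_isSyzygy s hIX N 1 le_rfl x
    (fun e' => smul_eq_zero_of_mem_cohomologyAnnihilatorOfDegree hx (by omega) e') e

/-- **`ca(R)` lies in the trace ideals of all ideals that are high syzygies.** If `x ∈ ca(R)`
(`R` a noetherian domain) then for some `s₀`, `x ∈ 𝔞·𝔞⁻¹` for every nonzero ideal `𝔞 ≅ Ωˢ X`,
`s ≥ s₀`, `X` finitely generated. (For rings all of whose high syzygies are sums of rank-one
modules — e.g. toric surfaces — this is the containment `ca(R) ⊆ ⋂_{𝔞 recurrent} 𝔞·𝔞⁻¹` of the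
toric scans; the reverse containment there needs the classification and is not claimed.)
[cite: IyengarTakahashi2014, Remark 2.13] -/
theorem exists_forall_mem_mul_inv_of_mem_cohomologyAnnihilator [IsNoetherianRing R] {x : R}
    (hx : x ∈ cohomologyAnnihilator R) :
    ∃ s₀ : ℕ, ∀ s : ℕ, s₀ ≤ s → ∀ (I : Ideal R), I ≠ ⊥ → ∀ (X : ModuleCat.{u} R), Module.Finite R X →
      IsSyzygy s X (ModuleCat.of R ↥I) →
        algebraMap R K x ∈ (I : FractionalIdeal R⁰ K) * (I : FractionalIdeal R⁰ K)⁻¹ := by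
  obtain ⟨s₀, hs₀⟩ := mem_cohomologyAnnihilator_iff.mp hx
  refine ⟨s₀, fun s hs I hI X hX hIX => ?_⟩
  haveI := hX
  exact mem_mul_inv_of_mem_cohomologyAnnihilatorOfDegree_of_isSyzygy I hI
    (cohomologyAnnihilatorOfDegree_mono (by omega) hs₀) hIX

end Summit.ResolutionOfSingularities.ResolutionOfSingularities.Theorems.HomologicalConductor.PersistenceTraceCriterion

end
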